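import Summits.CriticalPhenomena.PercolationContinuityZ3.Theorems.Transplant.FKConnectivityAllQAntipodalOddConeReduce4
import Summits.CriticalPhenomena.PercolationContinuityZ3.Theorems.Transplant.FKConnectivityAllQAntipodalOddConeRays4
import Summits.CriticalPhenomena.PercolationContinuityZ3.Theorems.Transplant.FKConnectivityAllQAntipodalOddConeRayAnd
import Summits.CriticalPhenomena.PercolationContinuityZ3.Theorems.Transplant.FKConnectivityAllQAntipodalOddConeRayMaj3
import Summits.CriticalPhenomena.PercolationContinuityZ3.Theorems.Transplant.FKConnectivityAllQAntipodalOddConeRayT1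
import Summits.CriticalPhenomena.PercolationContinuityZ3.Theorems.Transplant.FKConnectivityAllQAntipodalMinorWeightUpc

/-!
# Connectivity correlation inequalities for `φ_{w,q}`, every `q > 0` — file 64h: **`C_∞⁺` AT LEVEL 4 ON SERIES–PARALLEL GRAPHS, MODULO `T2⁺`**

Support file (`--supports stmt-CriticalPhenomena-4575`), FK sub-lane `prim-bschramm-fk-2` (gen 29); builds on p205010 (kernel theorem,
internal audit signed; external expert review pending).  No definitions, no named facts, no sorries; standard axioms.  Memo
FROM-fk-2-g29-BRIDGE.md §14.

THE MASTER FILE of the level-4 odd-cone assembly.  `𝓔` TTSP between `a, b`, `x = ab ∉ 𝓔` (so `H = 𝓔 ∪ {x}` is an arbitrary 2-connected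
series–parallel graph), `y, z, w ∈ 𝓔` three further distinct special edges, a cell `M` (free) / `C` (contracted) of `𝓔 \ {y,z,w}`; `f` ANY increasing
function reading only `x, y, z, w`; `g` increasing and blind to them.  The reduction of file 64f (`FK.OddCone.sum_antipodal_nonpos_of_rays4`: layer
cake + the `decide`d odd-cone table of file 64b) leaves the 23 ray inequalities of the cell; 19 of them are theorems of the lineage in every
placement — dictators: Theorem U levelwise (`FK.apPsiC_levels_le_pivot_nonpos_of_isTTSP`); `AND`: file 64c; `maj₃`: files 61z/64d; `T1`: files
63f/64e — and the four `T2` rays (`hub·OR(rest) ∨ AND(rest)`, hub `x, y, z, w`) are exactly Conjecture `T2⁺` (the serq square of memo §8/§13),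
taken here as hypotheses IN THE SAME CELL.  Hence `apPsiC_levels_le_read4_nonpos_of_T2`: **`C_∞⁺` at level 4 for every increasing `f` of four
edges holds in every cell of every 2-connected series–parallel graph in which the four `T2` inequalities hold**; unconditionally it holds for
every `f` whose threshold types avoid `T2` (not restated).
[cite: Grimmett2006, §1.4 eq. (1.20) (p. 15); §3.8 Thm. (3.90) (pp. 61–62); §3.9 (pp. 63–64)] [cite: Wagner2006, Thm. 5.8(d), §5.3]
-/

noncomputable section

namespace Summit.CriticalPhenomena.PercolationContinuityZ3.Theorems

namespace FK

open SimpleGraph Finset Literature.Probability.LatticeModels Literature.Probability.Percolation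
open scoped Classical

variable {V : Type*} [Fintype V]

/-- **`C_∞⁺` AT LEVEL 4, MODULO `T2⁺` (levelwise form).**  With `M' = {x,y,z,w} ∪ M` (`x = ab`), for every level cut-off `J`:
`Σ_{γ ⊆ M' : k(γ∪C)+k((M'\γ)∪C) ≤ J} (f(γ∪C) − f((M'\γ)∪C))·(g(γ∪C) − g((M'\γ)∪C)) ≤ 0`, provided the same inequality holds for the four
`T2` ray functions `FK.OddCone.ray4 r x y z w`, `r = 19, 20, 21, 22` (hypothesis `hT2`).
[cite: Grimmett2006, §3.8 Thm. (3.90) (pp. 61–62); §3.9 (pp. 63–64)] [cite: Wagner2006, Thm. 5.8(d), §5.3] -/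
theorem apPsiC_levels_le_read4_nonpos_of_T2 {E : Finset (Sym2 V)} {a b : V} (hE : IsTTSP E a b) (hx : s(a, b) ∉ E)
    {y z w : Sym2 V} (hy : y ∈ E) (hz : z ∈ E) (hw : w ∈ E) (hyz : y ≠ z) (hyw : y ≠ w) (hzw : z ≠ w)
    {M C : Finset (Sym2 V)} (hM : M ⊆ ((E.erase y).erase z).erase w) (hC : C ⊆ ((E.erase y).erase z).erase w)
    (hMC : Disjoint M C) {f : Finset (Sym2 V) → ℝ}
    (hf : ∀ A B : Finset (Sym2 V), (∀ e ∈ ({s(a, b), y, z, w} : Finset (Sym2 V)), (e ∈ A ↔ e ∈ B)) → f A = f B)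
    (hfm : ∀ ⦃X Y : Finset (Sym2 V)⦄, X ⊆ Y → f X ≤ f Y) {g : Finset (Sym2 V) → ℝ}
    (hg : ∀ A U : Finset (Sym2 V), U ⊆ ({s(a, b), y, z, w} : Finset (Sym2 V)) → g (A ∪ U) = g A)
    (hmono : ∀ ⦃X Y : Finset (Sym2 V)⦄, X ⊆ Y → g X ≤ g Y) (J : ℕ)
    (hT2 : ∀ r : Fin 23, 19 ≤ r.val →
      ∑ γ ∈ (insert s(a, b) (insert y (insert z (insert w M)))).powerset with
          apExpC (insert s(a, b) (insert y (insert z (insert w M)))) C γ ≤ J,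
        (OddCone.ray4 r s(a, b) y z w (γ ∪ C) - OddCone.ray4 r s(a, b) y z w ((insert s(a, b) (insert y (insert z (insert w M)))) \ γ ∪ C)) *
          (g (γ ∪ C) - g ((insert s(a, b) (insert y (insert z (insert w M)))) \ γ ∪ C)) ≤ 0) :
    ∑ γ ∈ (insert s(a, b) (insert y (insert z (insert w M)))).powerset with
        apExpC (insert s(a, b) (insert y (insert z (insert w M)))) C γ ≤ J,
      (f (γ ∪ C) - f ((insert s(a, b) (insert y (insert z (insert w M)))) \ γ ∪ C)) *
        (g (γ ∪ C) - g ((insert s(a, b) (insert y (insert z (insert w M)))) \ γ ∪ C)) ≤ 0 := by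
  -- names and the bookkeeping facts of the cell
  set x : Sym2 V := s(a, b) with hxdef
  set M' : Finset (Sym2 V) := insert x (insert y (insert z (insert w M))) with hM'def
  have hMe : M ⊆ E := hM.trans (((Finset.erase_subset _ _).trans (Finset.erase_subset _ _)).trans (Finset.erase_subset _ _))
  have hCe : C ⊆ E := hC.trans (((Finset.erase_subset _ _).trans (Finset.erase_subset _ _)).trans (Finset.erase_subset _ _))
  have hxy : x ≠ y := fun h => hx (h ▸ hy)
  have hxz : x ≠ z := fun h => hx (h ▸ hz)
  have hxw : x ≠ w := fun h => hx (h ▸ hw)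
  have hxM : x ∉ M := fun h => hx (hMe h)
  have hxC : x ∉ C := fun h => hx (hCe h)
  have hwM : w ∉ M := fun h => (Finset.mem_erase.1 (hM h)).1 rfl
  have hzM : z ∉ M := fun h => (Finset.mem_erase.1 (Finset.mem_of_mem_erase (hM h))).1 rfl
  have hyM : y ∉ M := fun h => (Finset.mem_erase.1 (Finset.mem_of_mem_erase (Finset.mem_of_mem_erase (hM h)))).1 rfl
  have hwC : w ∉ C := fun h => (Finset.mem_erase.1 (hC h)).1 rfl
  have hzC : z ∉ C := fun h => (Finset.mem_erase.1 (Finset.mem_of_mem_erase (hC h))).1 rfl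
  have hyC : y ∉ C := fun h => (Finset.mem_erase.1 (Finset.mem_of_mem_erase (Finset.mem_of_mem_erase (hC h)))).1 rfl
  have hxH : x ∈ insert x E := Finset.mem_insert_self _ _
  have hyH : y ∈ insert x E := Finset.mem_insert_of_mem hy
  have hzH : z ∈ insert x E := Finset.mem_insert_of_mem hz
  have hwH : w ∈ insert x E := Finset.mem_insert_of_mem hw
  have hMH : M ⊆ insert x E := hMe.trans (Finset.subset_insert _ _)
  have hCH : C ⊆ insert x E := hCe.trans (Finset.subset_insert _ _)
  have hM'H : M' ⊆ insert x E :=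
    Finset.insert_subset hxH (Finset.insert_subset hyH (Finset.insert_subset hzH (Finset.insert_subset hwH hMH)))
  have hM'C : Disjoint M' C := by
    rw [hM'def, Finset.disjoint_insert_left, Finset.disjoint_insert_left, Finset.disjoint_insert_left, Finset.disjoint_insert_left]
    exact ⟨hxC, hyC, hzC, hwC, hMC⟩
  have hxM' : x ∈ M' := Finset.mem_insert_self _ _
  have hyM' : y ∈ M' := Finset.mem_insert_of_mem (Finset.mem_insert_self _ _)
  have hzM' : z ∈ M' := Finset.mem_insert_of_mem (Finset.mem_insert_of_mem (Finset.mem_insert_self _ _))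
  have hwM' : w ∈ M' := Finset.mem_insert_of_mem (Finset.mem_insert_of_mem (Finset.mem_insert_of_mem (Finset.mem_insert_self _ _)))
  have hSM : ({x, y, z, w} : Finset (Sym2 V)) ⊆ M' :=
    Finset.insert_subset hxM' (Finset.insert_subset hyM' (Finset.insert_subset hzM' (Finset.singleton_subset_iff.2 hwM')))
  have hSC : Disjoint ({x, y, z, w} : Finset (Sym2 V)) C := by
    rw [Finset.disjoint_insert_left, Finset.disjoint_insert_left, Finset.disjoint_insert_left, Finset.disjoint_singleton_left]
    exact ⟨hxC, hyC, hzC, hwC⟩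
  have hSH : ({x, y, z, w} : Finset (Sym2 V)) ⊆ insert x E :=
    Finset.insert_subset hxH (Finset.insert_subset hyH (Finset.insert_subset hzH (Finset.singleton_subset_iff.2 hwH)))
  -- membership characterisation of `M'`
  have memM' : ∀ e : Sym2 V, e ∈ M' ↔ e = x ∨ e = y ∨ e = z ∨ e = w ∨ e ∈ M := fun e => by
    simp only [hM'def, Finset.mem_insert]
  -- blindness of `g` in insert form, and of `A ↦ g (A ∪ C)` to `C`
  have hgins : ∀ e ∈ ({x, y, z, w} : Finset (Sym2 V)), ∀ A : Finset (Sym2 V), g (insert e A) = g A := by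
    intro e he A
    rw [Finset.insert_eq, Finset.union_comm]
    exact hg A {e} (Finset.singleton_subset_iff.2 he)
  have hgC : ∀ e ∈ C, ∀ A : Finset (Sym2 V), (fun A => g (A ∪ C)) (insert e A) = (fun A => g (A ∪ C)) A := by
    intro e he A
    show g (insert e A ∪ C) = g (A ∪ C)
    rw [Finset.insert_union, Finset.insert_eq_of_mem (Finset.mem_union_right _ he)]
  have hmono' : ∀ ⦃A B : Finset (Sym2 V)⦄, A ⊆ B → B ⊆ M' → (fun A => g (A ∪ C)) A ≤ (fun A => g (A ∪ C)) B :=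
    fun A B hAB _ => hmono (Finset.union_subset_union hAB le_rfl)
  have hCC : ∀ A : Finset (Sym2 V), A ∪ C ∪ C = A ∪ C := fun A => by rw [Finset.union_assoc, Finset.union_idempotent]
  -- the reduction to the 23 rays
  refine OddCone.sum_antipodal_nonpos_of_rays4 hxy hxz hxw hyz hyw hzw hSM hSC (fun γ => apExpC M' C γ ≤ J)
    (fun γ => g (γ ∪ C) - g (M' \ γ ∪ C)) hf (fun P Q hPQ _ => hfm hPQ) ?_
  -- dictator rays: Theorem U levelwise at `e ∈ M'`, with `g ↦ g (· ∪ C)`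
  have dict : ∀ e ∈ ({x, y, z, w} : Finset (Sym2 V)),
      ∑ γ ∈ M'.powerset with apExpC M' C γ ≤ J,
        ((if e ∈ γ ∪ C then (1 : ℝ) else 0) - (if e ∈ M' \ γ ∪ C then 1 else 0)) * (g (γ ∪ C) - g (M' \ γ ∪ C)) ≤ 0 := by
    intro e he
    have heC : e ∉ C := Finset.disjoint_left.1 hSC he
    have key := apPsiC_levels_le_pivot_nonpos_of_isTTSP hE hx hM'H hCH hM'C (hSM he) J (g := fun A => g (A ∪ C))
      (fun A => by show g (insert e A ∪ C) = g (A ∪ C); rw [Finset.insert_union, hgins e he]) hgC hmono'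
    simp only [hCC] at key
    refine le_of_eq_of_le (Finset.sum_congr rfl fun γ _ => ?_) key
    have e1 : e ∈ γ ∪ C ↔ e ∈ γ := by rw [Finset.mem_union, or_iff_left heC]
    have e2 : e ∈ M' \ γ ∪ C ↔ e ∈ M' \ γ := by rw [Finset.mem_union, or_iff_left heC]
    simp only [e1, e2]
  -- AND rays: file 64c with `N = M' \ T`
  have andR : ∀ T : Finset (Sym2 V), T ⊆ ({x, y, z, w} : Finset (Sym2 V)) → T.Nonempty →
      ∑ γ ∈ M'.powerset with apExpC M' C γ ≤ J,
        ((if T ⊆ γ ∪ C then (1 : ℝ) else 0) - (if T ⊆ M' \ γ ∪ C then 1 else 0)) * (g (γ ∪ C) - g (M' \ γ ∪ C)) ≤ 0 := by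
    intro T hTS hTne
    have hTM' : T ⊆ M' := hTS.trans hSM
    have key := apPsiC_levels_le_andSet_nonpos_of_isTTSP hE hx (N := M' \ T) (T := T) (C := C)
      (Finset.sdiff_subset.trans hM'H) (hTS.trans hSH) hTne hCH Finset.sdiff_disjoint
      (hM'C.mono_left Finset.sdiff_subset) (hSC.mono_left hTS) J (fun A U hU => hg A U (hU.trans hTS)) hmono
    rw [Finset.sdiff_union_of_subset hTM'] at key
    exact key
  -- helpers: elements of `M` avoid the specials; erasing three specials from `H`
  have hMS : ∀ m ∈ M, m ∉ ({x, y, z, w} : Finset (Sym2 V)) := by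
    intro m hm h
    simp only [Finset.mem_insert, Finset.mem_singleton] at h
    rcases h with rfl | rfl | rfl | rfl
    · exact hxM hm
    · exact hyM hm
    · exact hzM hm
    · exact hwM hm
  have hEr3 : ∀ {e e₁ e₂ e₃ : Sym2 V}, e ∈ insert x E → e ≠ e₁ → e ≠ e₂ → e ≠ e₃ →
      e ∈ (((insert x E).erase e₁).erase e₂).erase e₃ := fun he h1 h2 h3 =>
    Finset.mem_erase.2 ⟨h3, Finset.mem_erase.2 ⟨h2, Finset.mem_erase.2 ⟨h1, he⟩⟩⟩
  have hAr3 : ∀ {e₁ e₂ e₃ : Sym2 V}, e₁ ∈ ({x, y, z, w} : Finset (Sym2 V)) → e₂ ∈ ({x, y, z, w} : Finset (Sym2 V)) →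
      e₃ ∈ ({x, y, z, w} : Finset (Sym2 V)) → ∀ {A : Finset (Sym2 V)}, A ⊆ E → (∀ m ∈ A, m ∉ ({x, y, z, w} : Finset (Sym2 V))) →
      A ⊆ (((insert x E).erase e₁).erase e₂).erase e₃ := by
    intro e₁ e₂ e₃ h1 h2 h3 A hA hAS m hm
    exact hEr3 (Finset.mem_insert_of_mem (hA hm)) (fun h => hAS m hm (h ▸ h1)) (fun h => hAS m hm (h ▸ h2))
      (fun h => hAS m hm (h ▸ h3))
  have hCS : ∀ m ∈ C, m ∉ ({x, y, z, w} : Finset (Sym2 V)) := fun m hm h => Finset.disjoint_left.1 hSC h hm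
  -- maj₃ rays: file 64d (61z re-rooted), specials `e₁,e₂,e₃`, the fourth special `e₄` joins the free set
  have majR : ∀ e₁ e₂ e₃ e₄ : Sym2 V, e₁ ∈ ({x, y, z, w} : Finset (Sym2 V)) → e₂ ∈ ({x, y, z, w} : Finset (Sym2 V)) →
      e₃ ∈ ({x, y, z, w} : Finset (Sym2 V)) → e₄ ∈ ({x, y, z, w} : Finset (Sym2 V)) →
      e₁ ≠ e₂ → e₁ ≠ e₃ → e₂ ≠ e₃ → e₄ ≠ e₁ → e₄ ≠ e₂ → e₄ ≠ e₃ →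
      insert e₁ (insert e₂ (insert e₃ (insert e₄ M))) = M' →
      ∑ γ ∈ M'.powerset with apExpC M' C γ ≤ J,
        ((if (e₁ ∈ γ ∪ C ∧ e₂ ∈ γ ∪ C) ∨ (e₁ ∈ γ ∪ C ∧ e₃ ∈ γ ∪ C) ∨ (e₂ ∈ γ ∪ C ∧ e₃ ∈ γ ∪ C) then (1 : ℝ) else 0) -
          (if (e₁ ∈ M' \ γ ∪ C ∧ e₂ ∈ M' \ γ ∪ C) ∨ (e₁ ∈ M' \ γ ∪ C ∧ e₃ ∈ M' \ γ ∪ C) ∨ (e₂ ∈ M' \ γ ∪ C ∧ e₃ ∈ M' \ γ ∪ C)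
            then (1 : ℝ) else 0)) * (g (γ ∪ C) - g (M' \ γ ∪ C)) ≤ 0 := by
    intro e₁ e₂ e₃ e₄ h1 h2 h3 h4 h12 h13 h23 h41 h42 h43 hI
    have hN : insert e₄ M ⊆ (((insert x E).erase e₁).erase e₂).erase e₃ :=
      Finset.insert_subset (hEr3 (hSH h4) h41 h42 h43) (hAr3 h1 h2 h3 hMe hMS)
    have hC' : C ⊆ (((insert x E).erase e₁).erase e₂).erase e₃ := hAr3 h1 h2 h3 hCe hCS
    have hNC : Disjoint (insert e₄ M) C := Finset.disjoint_insert_left.2 ⟨Finset.disjoint_left.1 hSC h4, hMC⟩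
    have key := apPsiC_levels_le_maj3Set_nonpos_of_isTTSP hE hx (hSH h1) (hSH h2) (hSH h3) h12 h13 h23 hN hC' hNC
      (hgins e₁ h1) (hgins e₂ h2) (hgins e₃ h3) hmono J
    rw [hI] at key
    exact key
  -- T1 rays: file 64e (63f re-rooted), AND pair `{p, q}`, OR pair `c, d`
  have T1R : ∀ p q c d : Sym2 V, p ∈ ({x, y, z, w} : Finset (Sym2 V)) → q ∈ ({x, y, z, w} : Finset (Sym2 V)) →
      c ∈ ({x, y, z, w} : Finset (Sym2 V)) → d ∈ ({x, y, z, w} : Finset (Sym2 V)) →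
      c ≠ d → c ≠ p → c ≠ q → d ≠ p → d ≠ q →
      M ∪ insert c (insert d {p, q}) = M' →
      ∑ γ ∈ M'.powerset with apExpC M' C γ ≤ J,
        ((if ({p, q} : Finset (Sym2 V)) ⊆ γ ∪ C ∧ (c ∈ γ ∪ C ∨ d ∈ γ ∪ C) then (1 : ℝ) else 0) -
          (if ({p, q} : Finset (Sym2 V)) ⊆ M' \ γ ∪ C ∧ (c ∈ M' \ γ ∪ C ∨ d ∈ M' \ γ ∪ C) then (1 : ℝ) else 0)) *
          (g (γ ∪ C) - g (M' \ γ ∪ C)) ≤ 0 := by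
    intro p q c d hp hq hc hd hcd hcp hcq hdp hdq hI
    have hS1 : ({p, q} : Finset (Sym2 V)) ⊆ ({x, y, z, w} : Finset (Sym2 V)) :=
      Finset.insert_subset hp (Finset.singleton_subset_iff.2 hq)
    have hU : insert c (insert d ({p, q} : Finset (Sym2 V))) ⊆ ({x, y, z, w} : Finset (Sym2 V)) :=
      Finset.insert_subset hc (Finset.insert_subset hd hS1)
    have hcS : c ∉ ({p, q} : Finset (Sym2 V)) := by
      rw [Finset.mem_insert, Finset.mem_singleton]; rintro (h | h); exacts [hcp h, hcq h]
    have hdS : d ∉ ({p, q} : Finset (Sym2 V)) := by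
      rw [Finset.mem_insert, Finset.mem_singleton]; rintro (h | h); exacts [hdp h, hdq h]
    have key := apPsiC_levels_le_orAttTSet_nonpos_of_isTTSP hE hx (N := M) (S₁ := ({p, q} : Finset (Sym2 V))) (C := C)
      (y := c) (z := d) hMH (hS1.trans hSH) ⟨p, Finset.mem_insert_self _ _⟩ hCH (hSH hc) (hSH hd) hcd
      (fun h => hMS c h hc) (fun h => hMS d h hd) hcS hdS (Finset.disjoint_left.1 hSC hc) (Finset.disjoint_left.1 hSC hd)
      (Finset.disjoint_left.2 fun m hm h => hMS m hm (hS1 h)) hMC (hSC.mono_left hS1) J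
      (fun A U hU' => hg A U (hU'.trans hU)) hmono
    rw [hI] at key
    exact key
  -- the dispatch over the 23 rays
  have mx : x ∈ ({x, y, z, w} : Finset (Sym2 V)) := by simp
  have my : y ∈ ({x, y, z, w} : Finset (Sym2 V)) := by simp
  have mz : z ∈ ({x, y, z, w} : Finset (Sym2 V)) := by simp
  have mw : w ∈ ({x, y, z, w} : Finset (Sym2 V)) := by simp
  intro r
  obtain ⟨k, hk⟩ := r
  interval_cases k
  · simp only [OddCone.ray4_val0 (r := ⟨0, hk⟩) rfl]; exact dict x mx
  · simp only [OddCone.ray4_val1 (r := ⟨1, hk⟩) rfl]; exact dict y my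
  · simp only [OddCone.ray4_val2 (r := ⟨2, hk⟩) rfl]; exact dict z mz
  · simp only [OddCone.ray4_val3 (r := ⟨3, hk⟩) rfl]; exact dict w mw
  · simp only [OddCone.ray4_val4 (r := ⟨4, hk⟩) rfl]; exact andR _ subset_rfl ⟨x, mx⟩
  · simp only [OddCone.ray4_val5 (r := ⟨5, hk⟩) rfl]
    exact andR _ (Finset.insert_subset mx (Finset.insert_subset my (Finset.singleton_subset_iff.2 mz))) ⟨x, by simp⟩
  · simp only [OddCone.ray4_val6 (r := ⟨6, hk⟩) rfl]
    exact andR _ (Finset.insert_subset mx (Finset.insert_subset my (Finset.singleton_subset_iff.2 mw))) ⟨x, by simp⟩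
  · simp only [OddCone.ray4_val7 (r := ⟨7, hk⟩) rfl]
    exact andR _ (Finset.insert_subset mx (Finset.insert_subset mz (Finset.singleton_subset_iff.2 mw))) ⟨x, by simp⟩
  · simp only [OddCone.ray4_val8 (r := ⟨8, hk⟩) rfl]
    exact andR _ (Finset.insert_subset my (Finset.insert_subset mz (Finset.singleton_subset_iff.2 mw))) ⟨y, by simp⟩
  · simp only [OddCone.ray4_val9 (r := ⟨9, hk⟩) rfl]
    exact majR x y z w mx my mz mw hxy hxz hyz hxw.symm hyw.symm hzw.symm hM'def.symm
  · simp only [OddCone.ray4_val10 (r := ⟨10, hk⟩) rfl]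
    exact majR x y w z mx my mw mz hxy hxw hyw hxz.symm hyz.symm hzw (by rw [hM'def]; ext e; clear * -; simp only [Finset.mem_insert]; tauto)
  · simp only [OddCone.ray4_val11 (r := ⟨11, hk⟩) rfl]
    exact majR x z w y mx mz mw my hxz hxw hzw hxy.symm hyz hyw (by rw [hM'def]; ext e; clear * -; simp only [Finset.mem_insert]; tauto)
  · simp only [OddCone.ray4_val12 (r := ⟨12, hk⟩) rfl]
    exact majR y z w x my mz mw mx hyz hyw hzw hxy hxz hxw (by rw [hM'def]; ext e; clear * -; simp only [Finset.mem_insert]; tauto)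
  · simp only [OddCone.ray4_val13 (r := ⟨13, hk⟩) rfl]
    exact T1R x y z w mx my mz mw hzw hxz.symm hyz.symm hxw.symm hyw.symm
      (by rw [hM'def]; ext e; clear * -; simp only [Finset.mem_union, Finset.mem_insert, Finset.mem_singleton]; tauto)
  · simp only [OddCone.ray4_val14 (r := ⟨14, hk⟩) rfl]
    exact T1R x z y w mx mz my mw hyw hxy.symm hyz hxw.symm hzw.symm
      (by rw [hM'def]; ext e; clear * -; simp only [Finset.mem_union, Finset.mem_insert, Finset.mem_singleton]; tauto)
  · simp only [OddCone.ray4_val15 (r := ⟨15, hk⟩) rfl]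
    exact T1R x w y z mx mw my mz hyz hxy.symm hyw hxz.symm hzw
      (by rw [hM'def]; ext e; clear * -; simp only [Finset.mem_union, Finset.mem_insert, Finset.mem_singleton]; tauto)
  · simp only [OddCone.ray4_val16 (r := ⟨16, hk⟩) rfl]
    exact T1R y z x w my mz mx mw hxw hxy hxz hyw.symm hzw.symm
      (by rw [hM'def]; ext e; clear * -; simp only [Finset.mem_union, Finset.mem_insert, Finset.mem_singleton]; tauto)
  · simp only [OddCone.ray4_val17 (r := ⟨17, hk⟩) rfl]
    exact T1R y w x z my mw mx mz hxz hxy hxw hyz.symm hzw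
      (by rw [hM'def]; ext e; clear * -; simp only [Finset.mem_union, Finset.mem_insert, Finset.mem_singleton]; tauto)
  · simp only [OddCone.ray4_val18 (r := ⟨18, hk⟩) rfl]
    exact T1R z w x y mz mw mx my hxy hxz hxw hyz hyw
      (by rw [hM'def]; ext e; clear * -; simp only [Finset.mem_union, Finset.mem_insert, Finset.mem_singleton]; tauto)
  · exact hT2 ⟨19, hk⟩ (by norm_num)
  · exact hT2 ⟨20, hk⟩ (by norm_num)
  · exact hT2 ⟨21, hk⟩ (by norm_num)
  · exact hT2 ⟨22, hk⟩ (by norm_num)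

end FK

end Summit.CriticalPhenomena.PercolationContinuityZ3.Theorems
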